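import Mathlib
import Summits.MatrixMultiplication.MatrixMultiplication.Theorems.SnSubsetDichotomyPolynomialSlackSplitBC

/-!
# Beyond one half, one dense quotient: the explicit volume bound

Crux `Summit.MatrixMultiplication.MatrixMultiplication.Theses.SnSubsetDichotomy.PolynomialSlack`
(item `stmt-MatrixMultiplication-8306`), level-one programme, lead c6 ("beyond one half"). The explicit
form of `volume_le_of_split_BC` used by the structure theorem: in the labelling where `A = S⁻¹T` is dense
(`K_A < 16M`) and `B, C` are not, with `F = n!√(n!)/N ≤ 8n^{C₁}`, the Frobenius floor `F² ≥ (n-1)/4`, pair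
logarithms `≤ L := log(256n³)`, `Λ := 200(1+log n)L`, the sharp excess `δ₄ := 8Λ²M^{5/2}n/(n-1)^{3/2}`
(valid for the sparser of `B, C`, whose co-density is `≥ √(K_BK_C) ≥ √((n-1)/(64M))`) and the level-one
error `≤ 8n^{C₁}(√6/√(n(n-1)) + 30√((1+log n)L/M)/√(n-1))`, the smallness hypothesis yields
`|S||T||U| ≤ 100Λ³(64n²M³)²/(n-1)³·B` (`volume_le_of_one_dense`), as `θ_Bθ_C = K_BK_C/(n²M²) ≥ (n-1)/(64n²M³)`.
-/

namespace Summit.MatrixMultiplication.MatrixMultiplication.Theorems.PolynomialSlack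

open scoped BigOperators
open Literature.Combinatorics.Additive (TripleProductProperty)

-- `Summit.<Summit>.<Problem>` is the tree's mandated summit-side namespace (CONVENTIONS §2); for
-- this single-conjunct summit the two coincide, so each declaration silences `dupNamespace`.
set_option linter.dupNamespace false

set_option maxHeartbeats 1600000 in
/-- **One dense quotient, explicit form.** In the labelling where `A = S⁻¹T` is dense (`K_A < 16M`) and
`B = T⁻¹U`, `C = U⁻¹S` are not (`K_B, K_C ≥ 16M`), a parity-pure TPP triple with `F = n!√(n!)/N ≤ 8n^{C₁}`,
`F² ≥ (n-1)/4`, pair logarithms `≤ log(256n³)` and the smallness condition on the explicit error terms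
satisfies `|S||T||U| ≤ 100·Λ³·(64n²M³)²/(n-1)³ · B`, `Λ = 200(1+log n)log(256n³)`, for every bound `B` on
the TPP volumes of `S_{n-1}`. [folklore] -/
theorem volume_le_of_one_dense {n : ℕ} (hn : 40 ≤ n) (B : ℕ)
    (hB : ∀ S' T' U' : Finset (Equiv.Perm (Fin (n - 1))), TripleProductProperty S' T' U' →
      S'.card * T'.card * U'.card ≤ B)
    {S T U : Finset (Equiv.Perm (Fin n))} (hTPP : TripleProductProperty S T U)
    (hS0 : S.Nonempty) (hT0 : T.Nonempty) (hU0 : U.Nonempty)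
    (hS : ∀ s ∈ S, ∀ s' ∈ S, Equiv.Perm.sign s = Equiv.Perm.sign s')
    (hT : ∀ t ∈ T, ∀ t' ∈ T, Equiv.Perm.sign t = Equiv.Perm.sign t')
    (hU : ∀ u ∈ U, ∀ u' ∈ U, Equiv.Perm.sign u = Equiv.Perm.sign u')
    (C₁ M : ℝ) (hM : 1 ≤ M)
    (hKA : (n.factorial : ℝ) / (S.card * T.card : ℕ) < 16 * M)
    (hKB : 16 * M ≤ (n.factorial : ℝ) / (T.card * U.card : ℕ))
    (hKC : 16 * M ≤ (n.factorial : ℝ) / (U.card * S.card : ℕ))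
    (hF : (n.factorial : ℝ) * Real.sqrt (n.factorial : ℝ) / (S.card * T.card * U.card : ℕ) ≤
      8 * (n : ℝ) ^ C₁)
    (hF2 : ((n : ℝ) - 1) / 4 ≤
      ((n.factorial : ℝ) * Real.sqrt (n.factorial : ℝ) / (S.card * T.card * U.card : ℕ)) ^ 2)
    (hLB : Real.log (4 * n * n.factorial / (T.card * U.card : ℕ)) ≤ Real.log (256 * (n : ℝ) ^ 3))
    (hLC : Real.log (4 * n * n.factorial / (U.card * S.card : ℕ)) ≤ Real.log (256 * (n : ℝ) ^ 3))
    (hsmall : 8 * (n : ℝ) ^ C₁ * (Real.sqrt 6 / Real.sqrt ((n : ℝ) * ((n : ℝ) - 1)) +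
        30 * Real.sqrt ((1 + Real.log n) * Real.log (256 * (n : ℝ) ^ 3) / M) / Real.sqrt ((n : ℝ) - 1)) +
        8 * (200 * (1 + Real.log n) * Real.log (256 * (n : ℝ) ^ 3)) ^ 2 * M ^ 2 * Real.sqrt M * n /
          (((n : ℝ) - 1) * Real.sqrt ((n : ℝ) - 1)) ≤
        1 / (64 * (200 * (1 + Real.log n) * Real.log (256 * (n : ℝ) ^ 3)) ^ 2)) :
    ((S.card * T.card * U.card : ℕ) : ℝ) ≤
      100 * (200 * (1 + Real.log n) * Real.log (256 * (n : ℝ) ^ 3)) ^ 3 * (64 * (n : ℝ) ^ 2 * M ^ 3) ^ 2 /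
        ((n : ℝ) - 1) ^ 3 * B := by
  classical
  /- scalars -/
  have hn1 : 1 ≤ n := by omega
  have hnR : (40 : ℝ) ≤ n := by exact_mod_cast hn
  have hn0 : (0 : ℝ) < n := by linarith
  have hm0 : (0 : ℝ) < (n : ℝ) - 1 := by linarith
  have hM0 : 0 < M := by linarith
  have hf0 : (0 : ℝ) < n.factorial := by exact_mod_cast n.factorial_pos
  have hG1 : 1 ≤ 1 + Real.log n := by
    have := Real.log_nonneg (show (1 : ℝ) ≤ n by linarith); linarith
  have hL1 : 1 ≤ Real.log (256 * (n : ℝ) ^ 3) := by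
    rw [← Real.log_exp 1]
    apply Real.log_le_log (Real.exp_pos 1)
    have h3 : (1 : ℝ) ≤ (n : ℝ) ^ 3 := one_le_pow₀ (by linarith)
    linarith [Real.exp_one_lt_d9]
  set Λ : ℝ := 200 * (1 + Real.log n) * Real.log (256 * (n : ℝ) ^ 3) with hΛ
  have hΛ1 : 1 ≤ Λ := by
    rw [hΛ]
    have : (1 : ℝ) * 1 ≤ (1 + Real.log n) * Real.log (256 * (n : ℝ) ^ 3) :=
      mul_le_mul hG1 hL1 zero_le_one (by linarith)
    linarith
  clear_value Λ
  set cS : ℝ := (S.card : ℝ) with hcS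
  set cT : ℝ := (T.card : ℝ) with hcT
  set cU : ℝ := (U.card : ℝ) with hcU
  have hcS0 : 0 < cS := by rw [hcS]; exact_mod_cast hS0.card_pos
  have hcT0 : 0 < cT := by rw [hcT]; exact_mod_cast hT0.card_pos
  have hcU0 : 0 < cU := by rw [hcU]; exact_mod_cast hU0.card_pos
  have hαe : ((S.card * T.card : ℕ) : ℝ) = cS * cT := by push_cast; rw [hcS, hcT]
  have hβe : ((T.card * U.card : ℕ) : ℝ) = cT * cU := by push_cast; rw [hcT, hcU]
  have hγe : ((U.card * S.card : ℕ) : ℝ) = cU * cS := by push_cast; rw [hcU, hcS]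
  have hNe : ((S.card * T.card * U.card : ℕ) : ℝ) = cS * cT * cU := by push_cast; rw [hcS, hcT, hcU]
  clear_value cS cT cU
  /- apply the split bound first (it is stated in the tree's raw vocabulary) -/
  obtain ⟨δ₄, hδ₄⟩ : ∃ δ₄ : ℝ, δ₄ = 8 * Λ ^ 2 * M ^ 2 * Real.sqrt M * n /
      (((n : ℝ) - 1) * Real.sqrt ((n : ℝ) - 1)) := ⟨_, rfl⟩
  have hδ₄0 : 0 ≤ δ₄ := by rw [hδ₄]; positivity
  have hmain : ∀ (hsharp : (Λ / ((n.factorial : ℝ) / ((T.card * U.card : ℕ) * n * M))) ^ 2 *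
        (n - 2).factorial / (T.card * U.card : ℕ) ≤ δ₄ ∨
      (Λ / ((n.factorial : ℝ) / ((U.card * S.card : ℕ) * n * M))) ^ 2 * (n - 2).factorial /
        (U.card * S.card : ℕ) ≤ δ₄)
      (hsm : (n.factorial : ℝ) / (2 * (S.card * T.card * U.card : ℕ)) +
          (n.factorial : ℝ) * Real.sqrt (n.factorial : ℝ) /
            (2 * (S.card * T.card * U.card : ℕ) * Real.sqrt (((n * (n - 1) : ℕ) : ℝ) / 6)) +
          3 * Real.sqrt (100 * (1 + Real.log n) * Real.log (256 * (n : ℝ) ^ 3) / M) *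
            ((n.factorial : ℝ) * Real.sqrt (n.factorial : ℝ) / (S.card * T.card * U.card : ℕ)) /
              Real.sqrt ((n : ℝ) - 1) + δ₄ ≤ 1 / (64 * Λ ^ 2)),
      ((S.card * T.card * U.card : ℕ) : ℝ) ≤ 100 * Λ ^ 3 * B /
        (((n : ℝ) - 1) * ((n.factorial : ℝ) / ((T.card * U.card : ℕ) * n * M)) ^ 2 *
          ((n.factorial : ℝ) / ((U.card * S.card : ℕ) * n * M)) ^ 2) := fun hsharp hsm =>
    volume_le_of_split_BC hn B hB hTPP hS0 hT0 hU0 hS hT hU M _ Λ δ₄ hM hL1 (le_of_eq hΛ.symm) hδ₄0 hKB hKC hLB hLC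
      hsharp hsm
  rw [hαe] at hKA; rw [hβe] at hKB hLB hmain; rw [hγe] at hKC hLC hmain; rw [hNe] at hF hF2 hmain ⊢
  /- the co-densities and the thresholds -/
  obtain ⟨KA, hKAdef⟩ : ∃ K : ℝ, K = (n.factorial : ℝ) / (cS * cT) := ⟨_, rfl⟩
  obtain ⟨KB, hKBdef⟩ : ∃ K : ℝ, K = (n.factorial : ℝ) / (cT * cU) := ⟨_, rfl⟩
  obtain ⟨KC, hKCdef⟩ : ∃ K : ℝ, K = (n.factorial : ℝ) / (cU * cS) := ⟨_, rfl⟩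
  rw [← hKAdef] at hKA; rw [← hKBdef] at hKB; rw [← hKCdef] at hKC
  have hKB0 : 0 < KB := by rw [hKBdef]; positivity
  have hKC0 : 0 < KC := by rw [hKCdef]; positivity
  have hKA0 : 0 < KA := by rw [hKAdef]; positivity
  obtain ⟨F, hFdef⟩ : ∃ F : ℝ, F = (n.factorial : ℝ) * Real.sqrt (n.factorial : ℝ) / (cS * cT * cU) :=
    ⟨_, rfl⟩
  rw [← hFdef] at hF hF2
  have hF0 : 0 < F := by rw [hFdef]; positivity
  have hKKK : KA * KB * KC = F ^ 2 := by
    rw [hKAdef, hKBdef, hKCdef, hFdef, div_pow, mul_pow, Real.sq_sqrt hf0.le]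
    field_simp
  -- `K_B K_C > (n-1)/(64 M)`
  have hKBC : ((n : ℝ) - 1) / (64 * M) ≤ KB * KC := by
    have h1 : KA * (KB * KC) = F ^ 2 := by rw [← hKKK]; ring
    have hKBC0 : 0 < KB * KC := mul_pos hKB0 hKC0
    have h2 : F ^ 2 < 16 * M * (KB * KC) := by rw [← h1]; exact mul_lt_mul_of_pos_right hKA hKBC0
    rw [div_le_iff₀ (by positivity)]
    linarith
  obtain ⟨θB, hθB⟩ : ∃ θ : ℝ, θ = (n.factorial : ℝ) / (cT * cU * n * M) := ⟨_, rfl⟩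
  obtain ⟨θC, hθC⟩ : ∃ θ : ℝ, θ = (n.factorial : ℝ) / (cU * cS * n * M) := ⟨_, rfl⟩
  rw [← hθB, ← hθC] at hmain
  have hθBe : θB = KB / (n * M) := by rw [hθB, hKBdef]; field_simp
  have hθCe : θC = KC / (n * M) := by rw [hθC, hKCdef]; field_simp
  have hθB0 : 0 < θB := by rw [hθBe]; positivity
  have hθC0 : 0 < θC := by rw [hθCe]; positivity
  have hθθ : ((n : ℝ) - 1) / (64 * (n : ℝ) ^ 2 * M ^ 3) ≤ θB * θC := by
    rw [hθBe, hθCe, div_mul_div_comm, div_le_div_iff₀ (by positivity) (by positivity)]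
    have h1 := hKBC
    rw [div_le_iff₀ (by positivity)] at h1
    calc ((n : ℝ) - 1) * (n * M * (n * M)) ≤ KB * KC * (64 * M) * (n * M * (n * M)) :=
          mul_le_mul_of_nonneg_right h1 (by positivity)
      _ = KB * KC * (64 * (n : ℝ) ^ 2 * M ^ 3) := by ring
  /- the sharp heavy-mass excess `δ₄` -/
  have hsq1 : Real.sqrt ((n : ℝ) - 1) ^ 2 = (n : ℝ) - 1 := Real.sq_sqrt hm0.le
  have hsqM : Real.sqrt M ^ 2 = M := Real.sq_sqrt hM0.le
  have hs10 : 0 < Real.sqrt ((n : ℝ) - 1) := Real.sqrt_pos.2 hm0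
  have hsM0 : 0 < Real.sqrt M := Real.sqrt_pos.2 hM0
  -- the larger of `K_B, K_C` is at least `√(n-1)/(8√M)`
  have hKZ : ∀ K : ℝ, KB * KC ≤ K ^ 2 → 0 < K → Real.sqrt ((n : ℝ) - 1) / (8 * Real.sqrt M) ≤ K := by
    intro K hK hK0
    rw [div_le_iff₀ (by positivity)]
    have h1 : ((n : ℝ) - 1) / (64 * M) ≤ K ^ 2 := hKBC.trans hK
    rw [div_le_iff₀ (by positivity)] at h1
    calc Real.sqrt ((n : ℝ) - 1) ≤ Real.sqrt (K ^ 2 * (8 ^ 2 * M)) := Real.sqrt_le_sqrt (by linarith)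
      _ = K * (8 * Real.sqrt M) := by
          rw [Real.sqrt_mul (sq_nonneg K), Real.sqrt_sq hK0.le, Real.sqrt_mul (by norm_num),
            Real.sqrt_sq (by norm_num)]
  -- the excess of a quotient with co-density `K`: `(Λ/θ)²(n-2)!/ζ = Λ² n M²/((n-1) K)`
  have hfact : (n.factorial : ℝ) = n * ((n : ℝ) - 1) * ((n - 2).factorial : ℝ) := by
    have h2 : n = (n - 2) + 2 := by omega
    conv_lhs => rw [h2]
    rw [Nat.factorial_succ, Nat.factorial_succ]
    push_cast
    have : (((n - 2 : ℕ) : ℝ)) = (n : ℝ) - 2 := by rw [Nat.cast_sub (by omega)]; norm_num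
    rw [this]; ring
  have hexcess : ∀ ζ : ℝ, 0 < ζ → (Λ / ((n.factorial : ℝ) / (ζ * n * M))) ^ 2 * (n - 2).factorial / ζ =
      Λ ^ 2 * n * M ^ 2 / (((n : ℝ) - 1) * ((n.factorial : ℝ) / ζ)) := by
    intro ζ hζ
    rw [hfact]
    field_simp
  have hsharp : (Λ / θB) ^ 2 * (n - 2).factorial / (cT * cU) ≤ δ₄ ∨
      (Λ / θC) ^ 2 * (n - 2).factorial / (cU * cS) ≤ δ₄ := by
    have hbound : ∀ K : ℝ, Real.sqrt ((n : ℝ) - 1) / (8 * Real.sqrt M) ≤ K → 0 < K →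
        Λ ^ 2 * n * M ^ 2 / (((n : ℝ) - 1) * K) ≤ δ₄ := by
      intro K hK hK0
      rw [hδ₄, div_le_div_iff₀ (by positivity) (by positivity)]
      have h1 : Real.sqrt ((n : ℝ) - 1) ≤ K * (8 * Real.sqrt M) := by
        rwa [div_le_iff₀ (by positivity)] at hK
      have h2 : 0 ≤ Λ ^ 2 * n * M ^ 2 * ((n : ℝ) - 1) := by positivity
      have h3 := mul_le_mul_of_nonneg_left h1 h2
      linarith [h3]
    rcases le_or_gt KB KC with h | h
    · right
      rw [hθC, hexcess _ (by positivity), ← hKCdef]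
      have hK : KB * KC ≤ KC ^ 2 := by nlinarith
      exact hbound KC (hKZ KC hK hKC0) hKC0
    · left
      rw [hθB, hexcess _ (by positivity), ← hKBdef]
      have hK : KB * KC ≤ KB ^ 2 := by nlinarith
      exact hbound KB (hKZ KB hK hKB0) hKB0
  /- the level-one error `δ ≤ δmax` -/
  have hD : Real.sqrt (((n * (n - 1) : ℕ) : ℝ) / 6) = Real.sqrt ((n : ℝ) * ((n : ℝ) - 1)) / Real.sqrt 6 := by
    have : (((n * (n - 1) : ℕ) : ℝ)) = (n : ℝ) * ((n : ℝ) - 1) := by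
      push_cast [Nat.cast_sub hn1]; ring
    rw [this, Real.sqrt_div' _ (by norm_num : (0 : ℝ) ≤ 6)]
  have hnn0 : 0 < (n : ℝ) * ((n : ℝ) - 1) := by positivity
  have hsnn : 0 < Real.sqrt ((n : ℝ) * ((n : ℝ) - 1)) := Real.sqrt_pos.2 hnn0
  have hs6 : 0 < Real.sqrt 6 := Real.sqrt_pos.2 (by norm_num)
  have hsf : Real.sqrt ((n : ℝ) * ((n : ℝ) - 1)) / Real.sqrt 6 ≤ Real.sqrt (n.factorial : ℝ) := by
    rw [div_le_iff₀ hs6, ← Real.sqrt_mul hf0.le]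
    apply Real.sqrt_le_sqrt
    have hnf : (n : ℝ) * ((n : ℝ) - 1) ≤ n.factorial := by
      have hh : n * (n - 1) ≤ n.factorial := by
        rw [← Nat.mul_factorial_pred (show n ≠ 0 by omega)]
        exact Nat.mul_le_mul_left n (Nat.self_le_factorial _)
      have e : ((n * (n - 1) : ℕ) : ℝ) = (n : ℝ) * ((n : ℝ) - 1) := by
        push_cast [Nat.cast_sub hn1]; ring
      rw [← e]; exact_mod_cast hh
    linarith [hnf, hf0.le]
  have hN0 : 0 < cS * cT * cU := by positivity
  have hδ12 : (n.factorial : ℝ) / (2 * (cS * cT * cU)) + (n.factorial : ℝ) * Real.sqrt (n.factorial : ℝ) /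
      (2 * (cS * cT * cU) * Real.sqrt (((n * (n - 1) : ℕ) : ℝ) / 6)) ≤
      F * (Real.sqrt 6 / Real.sqrt ((n : ℝ) * ((n : ℝ) - 1))) := by
    rw [hD, hFdef]
    obtain ⟨q, hq⟩ : ∃ q : ℝ, q = Real.sqrt 6 / Real.sqrt ((n : ℝ) * ((n : ℝ) - 1)) := ⟨_, rfl⟩
    rw [← hq]
    have hq0 : 0 < q := by rw [hq]; positivity
    have hq1 : 1 ≤ Real.sqrt (n.factorial : ℝ) * q := by
      rw [hq, mul_div_assoc', le_div_iff₀ hsnn, one_mul]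
      calc Real.sqrt ((n : ℝ) * ((n : ℝ) - 1))
          = Real.sqrt ((n : ℝ) * ((n : ℝ) - 1)) / Real.sqrt 6 * Real.sqrt 6 := by field_simp
        _ ≤ Real.sqrt (n.factorial : ℝ) * Real.sqrt 6 := mul_le_mul_of_nonneg_right hsf hs6.le
    have e1 : (n.factorial : ℝ) * Real.sqrt (n.factorial : ℝ) /
        (2 * (cS * cT * cU) * (Real.sqrt ((n : ℝ) * ((n : ℝ) - 1)) / Real.sqrt 6)) =
        (n.factorial : ℝ) * Real.sqrt (n.factorial : ℝ) / (cS * cT * cU) * q / 2 := by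
      rw [hq]; field_simp
    have e2 : (n.factorial : ℝ) / (2 * (cS * cT * cU)) ≤
        (n.factorial : ℝ) * Real.sqrt (n.factorial : ℝ) / (cS * cT * cU) * q / 2 := by
      rw [div_le_iff₀ (by positivity)]
      have h1 : (n.factorial : ℝ) ≤ (n.factorial : ℝ) * (Real.sqrt (n.factorial : ℝ) * q) := by
        have := mul_le_mul_of_nonneg_left hq1 hf0.le; linarith [this]
      calc (n.factorial : ℝ) ≤ (n.factorial : ℝ) * (Real.sqrt (n.factorial : ℝ) * q) := h1
        _ = (n.factorial : ℝ) * Real.sqrt (n.factorial : ℝ) / (cS * cT * cU) * q / 2 *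
            (2 * (cS * cT * cU)) := by field_simp
    rw [e1]; linarith
  have hδ3 : 3 * Real.sqrt (100 * (1 + Real.log n) * Real.log (256 * (n : ℝ) ^ 3) / M) *
      ((n.factorial : ℝ) * Real.sqrt (n.factorial : ℝ) / (cS * cT * cU)) / Real.sqrt ((n : ℝ) - 1) =
      F * (30 * Real.sqrt ((1 + Real.log n) * Real.log (256 * (n : ℝ) ^ 3) / M) / Real.sqrt ((n : ℝ) - 1)) := by
    have : Real.sqrt (100 * (1 + Real.log n) * Real.log (256 * (n : ℝ) ^ 3) / M) =
        10 * Real.sqrt ((1 + Real.log n) * Real.log (256 * (n : ℝ) ^ 3) / M) := by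
      rw [show 100 * (1 + Real.log n) * Real.log (256 * (n : ℝ) ^ 3) / M =
        10 ^ 2 * ((1 + Real.log n) * Real.log (256 * (n : ℝ) ^ 3) / M) by ring, Real.sqrt_mul (by norm_num),
        Real.sqrt_sq (by norm_num)]
    rw [this, hFdef]; ring
  have hδmax : (n.factorial : ℝ) / (2 * (cS * cT * cU)) + (n.factorial : ℝ) * Real.sqrt (n.factorial : ℝ) /
      (2 * (cS * cT * cU) * Real.sqrt (((n * (n - 1) : ℕ) : ℝ) / 6)) +
      3 * Real.sqrt (100 * (1 + Real.log n) * Real.log (256 * (n : ℝ) ^ 3) / M) *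
        ((n.factorial : ℝ) * Real.sqrt (n.factorial : ℝ) / (cS * cT * cU)) / Real.sqrt ((n : ℝ) - 1) ≤
      8 * (n : ℝ) ^ C₁ * (Real.sqrt 6 / Real.sqrt ((n : ℝ) * ((n : ℝ) - 1)) +
        30 * Real.sqrt ((1 + Real.log n) * Real.log (256 * (n : ℝ) ^ 3) / M) / Real.sqrt ((n : ℝ) - 1)) := by
    rw [hδ3]
    have h1 : 0 ≤ Real.sqrt 6 / Real.sqrt ((n : ℝ) * ((n : ℝ) - 1)) := by positivity
    have h2 : 0 ≤ 30 * Real.sqrt ((1 + Real.log n) * Real.log (256 * (n : ℝ) ^ 3) / M) /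
        Real.sqrt ((n : ℝ) - 1) := by positivity
    linarith [mul_le_mul_of_nonneg_right hF h1, mul_le_mul_of_nonneg_right hF h2, hδ12]
  /- conclude -/
  have hvol := hmain hsharp (by linarith [hδmax, hsmall])
  refine hvol.trans ?_
  have hB0 : (0 : ℝ) ≤ B := Nat.cast_nonneg _
  have hθθ0 : 0 < ((n : ℝ) - 1) / (64 * (n : ℝ) ^ 2 * M ^ 3) := by positivity
  have hlow : (((n : ℝ) - 1) / (64 * (n : ℝ) ^ 2 * M ^ 3)) ^ 2 ≤ (θB * θC) ^ 2 :=
    pow_le_pow_left₀ hθθ0.le hθθ 2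
  rw [div_le_iff₀ (by positivity)]
  have e : 100 * Λ ^ 3 * (64 * (n : ℝ) ^ 2 * M ^ 3) ^ 2 / ((n : ℝ) - 1) ^ 3 * B *
      (((n : ℝ) - 1) * θB ^ 2 * θC ^ 2) =
      100 * Λ ^ 3 * B * ((θB * θC) ^ 2 * ((64 * (n : ℝ) ^ 2 * M ^ 3) ^ 2 / ((n : ℝ) - 1) ^ 2)) := by
    field_simp
  rw [e]
  have h1 : 1 ≤ (θB * θC) ^ 2 * ((64 * (n : ℝ) ^ 2 * M ^ 3) ^ 2 / ((n : ℝ) - 1) ^ 2) := by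
    have e2 : (θB * θC) ^ 2 * ((64 * (n : ℝ) ^ 2 * M ^ 3) ^ 2 / ((n : ℝ) - 1) ^ 2) =
        (θB * θC) ^ 2 / (((n : ℝ) - 1) / (64 * (n : ℝ) ^ 2 * M ^ 3)) ^ 2 := by
      field_simp
    rw [e2, le_div_iff₀ (by positivity)]
    linarith
  have h0 : 0 ≤ 100 * Λ ^ 3 * (B : ℝ) := by positivity
  have h2 := mul_le_mul_of_nonneg_left h1 h0
  linarith [h2]

end Summit.MatrixMultiplication.MatrixMultiplication.Theorems.PolynomialSlack
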